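import Summits.CriticalPhenomena.CardyFormulaZ2.Theses.CardyBoundaryCoulombGas
import Summits.CriticalPhenomena.CardyFormulaZ2.Theses.CardyTotalPositivity
import Literature.Probability.Percolation.RSW

/-!
# `HalfPlaneOneArmThird` (stmt-CriticalPhenomena-5662), negative side I: the parametrised family,
# junk audit, and the degenerate parameters `p = 0`, `p = 1`

Negative-side support for the crux `HalfPlaneOneArmThird` of routes `CardyBoundaryCoulombGas` /
`CardyTotalPositivity` (cdisprove unit): `log P_{1/2}[0 ↔ ∂([-n,n]×[0,n]) inside the half-box] / log n
→ -1/3`, the half-plane one-arm exponent `β₁⁺ = 1/3` of bond-`ℤ²`.  The crux is the universality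
conjecture for this boundary exponent (a theorem only on site-`𝕋`, Smirnov–Werner 2001 Thm. 3) and is
NOT refuted; these files record, sorry-free, what any proof must use and what the rigorous `ℤ²`
theory of the tree pins down.  Part I (this file):

* `ExponentAt p β` — the family `log P_p[armEvt n] / log n → -β`; the crux is `ExponentAt half (1/3)`
  on the nose (`crux_iff`) and the two route copies coincide (`crux_shared`);
* junk audit: `armEvt_zero`/`prob_zero_eq_one` (`P_0 = 1`, the `n = 0` term is `log 1 / log 0 = 0`),
  `pow_le_prob` (`p ^ n ≤ P_n` by the open bottom row, so `P_n > 0` for `p > 0` and `Real.log` never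
  meets its junk point along the sequence);
* degenerate parameters: `exponentAt_one_iff`, `exponentAt_zero_iff` (at `p = 1` and `p = 0` the
  sequence is identically `0`, so the limit exists and equals `0`): `crux_false_at_one`,
  `crux_false_at_zero`.

Parts II (`Window.lean`: subcritical divergence, the window `α₀ ≤ β ≤ 1` at `p = 1/2`) and III
(`ParameterPinned.lean`: supercritical limit `0`, the statement is false at every `p ≠ 1/2`) build
on this file.
-/

noncomputable section

namespace Summit.CriticalPhenomena.CardyFormulaZ2.Theorems.HalfPlaneOneArmThird.Negative

open MeasureTheory ProbabilityTheory Filter Topology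
open Literature.Probability.Percolation Literature.Probability.LatticeModels

/-! ## The parametrised family -/

/-- The half-box `[-n, n] × [0, n]` of the crux. -/
def halfBox (n : ℕ) : Set (Site 2) := {v | 0 ≤ v 1 ∧ -(n : ℤ) ≤ v 0 ∧ v 0 ≤ n ∧ v 1 ≤ n}

/-- The crux event at scale `n`: `0` is joined inside the half-box to its outer boundary
`{y₀ = n} ∪ {y₀ = -n} ∪ {y₁ = n}`. -/
def armEvt (n : ℕ) : Set (BondConfig (Site 2)) :=
  {ω | ∃ y : Site 2, (y 0 = (n : ℤ) ∨ y 0 = -(n : ℤ) ∨ y 1 = (n : ℤ)) ∧ ω ∈ openConnIn (halfBox n) 0 y}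

/-- `P_p[armEvt n]`. -/
def prob (p : unitInterval) (n : ℕ) : ℝ := (bondPercolation (zdGraph 2) p).real (armEvt n)

/-- "The half-plane one-arm exponent of bond-`ℤ²` at parameter `p` exists and equals `β`":
`log P_p[armEvt n] / log n → -β`.  The crux is `ExponentAt half (1/3)` (`crux_iff`). -/
def ExponentAt (p : unitInterval) (β : ℝ) : Prop :=
  Tendsto (fun n : ℕ ↦ Real.log (prob p n) / Real.log n) atTop (𝓝 (-β))

/-- The crux, unfolded: it is `ExponentAt half (1/3)` on the nose. -/
theorem crux_iff : Theses.CardyBoundaryCoulombGas.HalfPlaneOneArmThird ↔ ExponentAt half (1 / 3) :=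
  Iff.rfl

/-- The two route copies of the item are the same proposition. -/
theorem crux_shared :
    Theses.CardyBoundaryCoulombGas.HalfPlaneOneArmThird ↔
      Theses.CardyTotalPositivity.HalfPlaneOneArmThird := Iff.rfl

/-! ## Junk values and the trivial lower bound -/

/-- At `n = 0` the event is sure (`y = 0` is already on the "boundary"), so `P_0 = 1` and the
`n = 0` term of the sequence is `log 1 / log 0 = 0`. -/
theorem armEvt_zero : armEvt 0 = Set.univ := by
  refine Set.eq_univ_of_forall fun ω => ⟨0, by simp, ?_⟩
  have h0 : (0 : Site 2) ∈ halfBox 0 := by simp [halfBox]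
  exact ⟨h0, h0, SimpleGraph.Reachable.refl _⟩

/-- `P_p[armEvt 0] = 1`. -/
theorem prob_zero_eq_one (p : unitInterval) : prob p 0 = 1 := by
  simp [prob, armEvt_zero]

/-- `(k, 0)` as a site. -/
theorem pt_zero_zero : pt 0 0 = (0 : Site 2) := by
  ext i; fin_cases i <;> simp [pt]

/-- If the `n` bottom-row edges `{(i,0),(i+1,0)}`, `0 ≤ i < n`, are open then the crux event holds
(the bottom row joins `0` to `(n, 0)` inside the half-box). -/
theorem mem_armEvt_of_bottomRowEdges_subset {n : ℕ} {ω : BondConfig (Site 2)}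
    (h : (↑(bottomRowEdges n) : Set (Sym2 (Site 2))) ⊆ ω) : ω ∈ armEvt n := by
  have hmem : ∀ k : ℕ, k ≤ n → pt k 0 ∈ halfBox n := by
    intro k hk
    simp only [halfBox, Set.mem_setOf_eq, pt, Matrix.cons_val_zero, Matrix.cons_val_one,
      Matrix.cons_val_fin_one]
    omega
  have hreach : ∀ k : ℕ, ∀ hk : k ≤ n,
      ((openGraph ω).induce (halfBox n)).Reachable ⟨pt 0 0, hmem 0 (Nat.zero_le n)⟩
        ⟨pt k 0, hmem k hk⟩ := by
    intro k
    induction k with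
    | zero => intro hk; exact SimpleGraph.Reachable.refl _
    | succ k ih =>
      intro hk
      refine (ih (Nat.le_of_succ_le hk)).trans (SimpleGraph.Adj.reachable ?_)
      rw [SimpleGraph.induce_adj, openGraph_adj]
      refine ⟨h ?_, ?_⟩
      · simp only [bottomRowEdges, Finset.coe_image, Finset.coe_range, Set.mem_image, Set.mem_Iio]
        exact ⟨k, Nat.lt_of_succ_le hk, by push_cast; rfl⟩
      · intro heq
        have := congr_fun heq 0
        simp [pt] at this
  refine ⟨pt n 0, Or.inl (by simp [pt]), ?_⟩
  have h0 : (0 : Site 2) ∈ halfBox n := pt_zero_zero ▸ hmem 0 (Nat.zero_le n)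
  refine ⟨h0, hmem n le_rfl, ?_⟩
  have := hreach n le_rfl
  convert this using 2; simp [pt_zero_zero]

/-- **Trivial lower bound** `p ^ n ≤ P_p[armEvt n]` (open bottom row).  In particular `P_n > 0`
for `p > 0`, so along the crux sequence `Real.log` is never evaluated at its junk point `0`. -/
theorem pow_le_prob (p : unitInterval) (n : ℕ) : (p : ℝ) ^ n ≤ prob p n := by
  have hcard : (bottomRowEdges n).card ≤ n := by
    simpa [bottomRowEdges] using (Finset.card_image_le (s := Finset.range n)
      (f := fun i : ℕ => s(pt i 0, pt (i + 1) 0)))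
  calc (p : ℝ) ^ n ≤ (p : ℝ) ^ (bottomRowEdges n).card :=
        pow_le_pow_of_le_one p.2.1 p.2.2 hcard
    _ = (bondPercolation (zdGraph 2) p).real
          {ω | (↑(bottomRowEdges n) : Set (Sym2 (Site 2))) ⊆ ω} :=
        (bondPercolation_real_setOf_subset _ p _ (bottomRowEdges_subset_edgeSet n)).symm
    _ ≤ prob p n := measureReal_mono (fun ω hω => mem_armEvt_of_bottomRowEdges_subset hω)

/-- `P_n ≤ 1`. -/
theorem prob_le_one (p : unitInterval) (n : ℕ) : prob p n ≤ 1 := measureReal_le_one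

/-- `0 ≤ P_n`. -/
theorem prob_nonneg (p : unitInterval) (n : ℕ) : 0 ≤ prob p n := measureReal_nonneg

/-- `P_n > 0` as soon as `p > 0`. -/
theorem prob_pos {p : unitInterval} (hp : 0 < (p : ℝ)) (n : ℕ) : 0 < prob p n :=
  (pow_pos hp n).trans_le (pow_le_prob p n)

/-! ## (a) The parameter `p = 1/2` is load-bearing -/

/-- At `p = 1` the event is almost sure: `P_1[armEvt n] = 1`. -/
theorem prob_one (n : ℕ) : prob 1 n = 1 :=
  le_antisymm (prob_le_one 1 n) (by simpa using pow_le_prob 1 n)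

/-- At `p = 1` the crux sequence is identically `0`, so the limit exists and is `0`:
`ExponentAt 1 β ↔ β = 0`. -/
theorem exponentAt_one_iff (β : ℝ) : ExponentAt 1 β ↔ β = 0 := by
  have h : (fun n : ℕ ↦ Real.log (prob 1 n) / Real.log n) = fun _ => 0 := by
    funext n; simp [prob_one]
  rw [ExponentAt, h, tendsto_const_nhds_iff]
  constructor <;> intro h <;> linarith

/-- `HalfPlaneOneArmThird` with `p = 1` in place of `p = 1/2` is false. -/
theorem crux_false_at_one : ¬ ExponentAt 1 (1 / 3) := by
  rw [exponentAt_one_iff]; norm_num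

/-- At `p = 0` and `n ≥ 1` the event fails surely: the empty configuration joins `0` to nothing. -/
theorem prob_zero {n : ℕ} (hn : 1 ≤ n) : prob 0 n = 0 := by
  have hempty : (∅ : BondConfig (Site 2)) ∉ armEvt n := by
    rintro ⟨y, hy, h0, hyS, hr⟩
    have hbot : (openGraph (∅ : BondConfig (Site 2))).induce (halfBox n) = ⊥ := by
      ext a b
      simp [openGraph_adj]
    rw [hbot, SimpleGraph.reachable_bot] at hr
    have hy0 : y = 0 := by simpa using congrArg Subtype.val hr.symm
    subst hy0
    simp at hy
    omega
  simp only [prob, bondPercolation, setBernoulli_zero, measureReal_def, Measure.dirac_apply,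
    Set.indicator_of_notMem hempty, ENNReal.toReal_zero]

/-- At `p = 0` the crux sequence is identically `0` (`log 0 = 0` is Lean's junk value for
`n ≥ 1`, and `log 1 / log 0 = 0` at `n = 0`), so `ExponentAt 0 β ↔ β = 0`. -/
theorem exponentAt_zero_iff (β : ℝ) : ExponentAt 0 β ↔ β = 0 := by
  have h : (fun n : ℕ ↦ Real.log (prob 0 n) / Real.log n) = fun _ => 0 := by
    funext n
    rcases Nat.eq_zero_or_pos n with rfl | hn
    · simp [prob_zero_eq_one]
    · simp [prob_zero hn]
  rw [ExponentAt, h, tendsto_const_nhds_iff]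
  constructor <;> intro h <;> linarith

/-- `HalfPlaneOneArmThird` with `p = 0` in place of `p = 1/2` is false. -/
theorem crux_false_at_zero : ¬ ExponentAt 0 (1 / 3) := by
  rw [exponentAt_zero_iff]; norm_num

end Summit.CriticalPhenomena.CardyFormulaZ2.Theorems.HalfPlaneOneArmThird.Negative

end
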